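import Mathlib
import Summits.ValiantsHypothesis.ValiantsHypothesis.Theorems.FifoMatchingNNMonotoneHardBoundaries
import HarnessLib

/-!
# Crux `NNMonotoneHard` (stmt-ValiantsHypothesis-11617), piece (D4) of `Cruxes/NNMonotoneHard/PROOF-PLAN.md`:
# the block analysis — a balanced respected colouring of a thick queue has many boundaries

On the abstract queue history of `FifoMatchingNNMonotoneHardBoundaries.lean` (ranks `rO`, `rC`,
arc times `o`, `c`, respected colouring `σ`, thick window `[A, E]` with queue lengths in
`[L − m, L + m]`), cut the window into `J` consecutive blocks of length `K ≥ 2L + 4m + 2`.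

`exists_many_boundaries`: if each colour occupies at least `Q` positions of the block region and
`4r ≤ J`, `2Kr ≤ Q`, `2mr + 3m ≤ L`, then for some colour `x` there are at least `r` boundaries
INTO `x` (times `u` with `σ(u−1) ≠ x`, `σ u = x`) in the window.  Cases: many blocks contain a
boundary (each gives one); or all boundary-free blocks have one colour (then the other colour
lives in the few blocks with boundaries — too few positions); or two boundary-free blocks have
different colours (then the queue is monochromatic of each colour at some time, by (D2), and the
potential argument `many_boundaries_of_two_colours` applies).  Boundaries into a fixed colour are
pairwise `≥ 2` apart, which is what the test lemma needs.

Honest framing: elementary combinatorics; VP ≠ VNP is not moved by anything here.  No definitions,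
no named facts.
-/

-- Sub = Summit single-conjunct layout: the duplicated namespace component is mandated by the tree.
set_option linter.dupNamespace false

namespace Summit.ValiantsHypothesis.ValiantsHypothesis.Theorems.FifoMatching.NNMonotoneHard

open Finset

section Blocks

variable {W σ : ℕ → Bool} {rO rC o c : ℕ → ℕ} {n' : ℕ}
variable (hO0 : rO 0 = 0) (hC0 : rC 0 = 0)
  (hOs : ∀ t, rO (t + 1) = rO t + (if W t = true then 1 else 0))
  (hCs : ∀ t, rC (t + 1) = rC t + (if W t = true then 0 else 1))
  (ho : ∀ k t, k < n' → (o k < t ↔ k < rO t))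
  (hc : ∀ k t, k < n' → (c k < t ↔ k < rC t))
  (hresp : ∀ k, k < n' → σ (o k) = σ (c k))

/-- A boundary-free block is monochromatic: `σ` is constant on `[a, b)` if `σ (u−1) = σ u` for
all `a < u < b`. [folklore] -/
theorem const_of_no_boundary {a b : ℕ} (hnb : ∀ u, a < u → u < b → σ (u - 1) = σ u)
    {t : ℕ} (hat : a ≤ t) (htb : t < b) : σ t = σ a := by
  induction t, hat using Nat.le_induction with
  | base => rfl
  | succ t hat ih =>
    have := hnb (t + 1) (by omega) htb
    rw [Nat.add_sub_cancel] at this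
    rw [← this, ih (by omega)]

include hO0 hC0 hOs hCs ho hc hresp in
/-- **(D4) Many boundaries.**  Blocks `[A + jK, A + (j+1)K)`, `j < J`, of length
`K ≥ 2L + 4m + 2` inside the thick window `[A, E]` (queue lengths in `[L − m, L + m]`,
`rO E ≤ n'`); each colour has at least `Q` positions in the block region; `4r ≤ J`, `2Kr ≤ Q`,
`2mr + 3m ≤ L`, `m ≥ 1`.  Then some colour `x` has at least `r` boundaries into it in `(A, E]`.
[folklore] -/
theorem exists_many_boundaries {A K J E L m r Q : ℕ} (hK : 2 * L + 4 * m + 2 ≤ K)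
    (hJE : A + J * K ≤ E) (hn : rO E ≤ n')
    (hband : ∀ t, A ≤ t → t ≤ E → L ≤ rO t - rC t + m ∧ rO t ≤ rC t + L + m ∧ rC t ≤ rO t)
    (hbal : ∀ b : Bool, Q ≤ ((range (A + J * K)).filter fun t => A ≤ t ∧ σ t = b).card)
    (hr1 : 4 * r ≤ J) (hr2 : 2 * K * r ≤ Q) (hr3 : 2 * m * r + 3 * m ≤ L) (hm : 1 ≤ m) :
    ∃ x : Bool, r ≤ ((range (E + 1)).filter fun u => A < u ∧ σ (u - 1) ≠ x ∧ σ u = x).card := by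
  classical
  -- the boundary sets
  set Bd : Bool → Finset ℕ := fun x =>
    (range (E + 1)).filter fun u => A < u ∧ σ (u - 1) ≠ x ∧ σ u = x with hBd
  by_contra hcon
  push Not at hcon
  have hlt : ∀ x, (Bd x).card < r := fun x => by simpa [hBd] using hcon x
  have hr0 : 1 ≤ r := by
    rcases Nat.eq_zero_or_pos r with h | h
    · exact absurd (hlt true) (by rw [h]; exact Nat.not_lt_zero _)
    · exact h
  -- blocks with / without a boundary inside
  set mono : ℕ → Prop := fun j => ∀ u, A + j * K < u → u < A + (j + 1) * K → σ (u - 1) = σ u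
    with hmono
  set NM := (range J).filter fun j => ¬ mono j with hNM
  set MB := (range J).filter fun j => mono j with hMB
  have hsplit : MB.card + NM.card = J := by
    rw [hMB, hNM, card_filter_add_card_filter_not, card_range]
  -- (i) each block with a boundary contributes a boundary
  have hchoice : ∀ j ∈ NM, ∃ u, A + j * K < u ∧ u < A + (j + 1) * K ∧ σ (u - 1) ≠ σ u := by
    intro j hj
    rw [hNM, mem_filter] at hj
    have := hj.2
    simp only [hmono, not_forall, exists_prop] at this
    obtain ⟨u, h1, h2, h3⟩ := this
    exact ⟨u, h1, h2, h3⟩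
  choose! ub hub using hchoice
  have hub_mem : ∀ j ∈ NM, ub j ∈ Bd true ∪ Bd false := by
    intro j hj
    obtain ⟨h1, h2, h3⟩ := hub j hj
    have hjJ : j < J := mem_range.1 (mem_filter.1 hj).1
    have huE : ub j ≤ E := by
      have : (j + 1) * K ≤ J * K := Nat.mul_le_mul_right _ (by omega)
      omega
    have huA : A < ub j := by
      have : 0 ≤ j * K := Nat.zero_le _
      omega
    rw [mem_union]
    simp only [hBd, mem_filter, mem_range]
    cases hσu : σ (ub j)
    · right; refine ⟨by omega, huA, ?_, rfl⟩
      intro h; rw [h] at h3; exact h3 hσu.symm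
    · left; refine ⟨by omega, huA, ?_, rfl⟩
      intro h; rw [h] at h3; exact h3 hσu.symm
  have hub_inj : Set.InjOn ub ↑NM := by
    intro j hj j' hj' hjj
    obtain ⟨h1, h2, -⟩ := hub j hj
    obtain ⟨h1', h2', -⟩ := hub j' hj'
    rw [hjj] at h1 h2
    -- `ub j'` lies in block `j` and in block `j'`
    by_contra hne
    rcases lt_or_gt_of_ne hne with hl | hl
    · have : (j + 1) * K ≤ j' * K := Nat.mul_le_mul_right _ (by omega)
      omega
    · have : (j' + 1) * K ≤ j * K := Nat.mul_le_mul_right _ (by omega)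
      omega
  have hNM_le : NM.card ≤ (Bd true).card + (Bd false).card := by
    calc NM.card ≤ (Bd true ∪ Bd false).card := by
          rw [← card_image_of_injOn hub_inj]
          exact card_le_card fun u hu => by
            obtain ⟨j, hj, rfl⟩ := mem_image.1 hu
            exact hub_mem j hj
      _ ≤ (Bd true).card + (Bd false).card := card_union_le _ _
  have hNM_lt : NM.card + 2 ≤ 2 * r := by
    have := hlt true; have := hlt false; omega
  -- so there are many boundary-free blocks
  have hMB_ge : 2 * r ≤ MB.card := by omega
  -- colour of a boundary-free block
  have hcolour : ∀ j ∈ MB, ∀ t, A + j * K ≤ t → t < A + (j + 1) * K → σ t = σ (A + j * K) := by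
    intro j hj t h1 h2
    exact const_of_no_boundary (mem_filter.1 hj).2 h1 h2
  by_cases hall : ∃ x, ∀ j ∈ MB, σ (A + j * K) = x
  · -- (ii) all boundary-free blocks have colour `x`: colour `!x` is confined to `NM` blocks
    obtain ⟨x, hx⟩ := hall
    have hsub : ((range (A + J * K)).filter fun t => A ≤ t ∧ σ t = !x) ⊆
        NM.biUnion fun j => Finset.Ico (A + j * K) (A + (j + 1) * K) := by
      intro t ht
      rw [mem_filter, mem_range] at ht
      obtain ⟨htlt, hAt, hσt⟩ := ht
      -- the block of `t`
      have hKpos : 0 < K := by omega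
      have hdm := Nat.div_add_mod' (t - A) K
      have hml := Nat.mod_lt (t - A) hKpos
      set j := (t - A) / K with hj
      have hj1 : A + j * K ≤ t := by omega
      have hj2 : t < A + (j + 1) * K := by
        have e1 : (j + 1) * K = j * K + K := by ring
        omega
      have hjJ : j < J := by
        by_contra hge; rw [not_lt] at hge
        have : J * K ≤ j * K := Nat.mul_le_mul_right _ hge
        omega
      rw [mem_biUnion]
      refine ⟨j, ?_, Finset.mem_Ico.2 ⟨hj1, hj2⟩⟩
      rw [hNM, mem_filter, mem_range]
      refine ⟨hjJ, fun hm => ?_⟩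
      have hjMB : j ∈ MB := by rw [hMB, mem_filter, mem_range]; exact ⟨hjJ, hm⟩
      have := hcolour j hjMB t hj1 hj2
      rw [hx j hjMB] at this
      rw [this] at hσt
      cases x <;> simp at hσt
    have hcount : ((range (A + J * K)).filter fun t => A ≤ t ∧ σ t = !x).card ≤ NM.card * K := by
      calc ((range (A + J * K)).filter fun t => A ≤ t ∧ σ t = !x).card
          ≤ (NM.biUnion fun j => Finset.Ico (A + j * K) (A + (j + 1) * K)).card := card_le_card hsub
        _ ≤ ∑ j ∈ NM, (Finset.Ico (A + j * K) (A + (j + 1) * K)).card := card_biUnion_le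
        _ = ∑ _j ∈ NM, K := by
            refine sum_congr rfl fun j _ => ?_
            rw [Nat.card_Ico]; ring_nf; omega
        _ = NM.card * K := by rw [sum_const, smul_eq_mul]
    have hQ := hbal (!x)
    have : Q < 2 * K * r := by
      calc Q ≤ NM.card * K := hQ.trans hcount
        _ < 2 * r * K := by
            apply Nat.mul_lt_mul_of_pos_right
            · omega
            · omega
        _ = 2 * K * r := by ring
    omega
  · -- (iii) two boundary-free blocks of different colours
    push Not at hall
    have hMBne : MB.Nonempty := by
      rw [← card_pos]; omega
    obtain ⟨j₀, hj₀⟩ := hMBne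
    obtain ⟨j₃, hj₃, hne⟩ := hall (σ (A + j₀ * K))
    -- order the two blocks: `j₁ < j₂`, colours `x` and `≠ x`
    have key : ∀ j₁ ∈ MB, ∀ j₂ ∈ MB, j₁ < j₂ → σ (A + j₂ * K) ≠ σ (A + j₁ * K) → False := by
      intro j₁ hj₁ j₂ hj₂ hlt12 hneq
      set x := σ (A + j₁ * K) with hxdef
      have hj₁J : j₁ < J := mem_range.1 (mem_filter.1 hj₁).1
      have hj₂J : j₂ < J := mem_range.1 (mem_filter.1 hj₂).1
      set e := A + (j₁ + 1) * K with hedef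
      set s := A + j₂ * K with hsdef
      have e1 : (j₁ + 1) * K = j₁ * K + K := by ring
      have e2 : (j₂ + 1) * K = j₂ * K + K := by ring
      have hm12 : (j₁ + 1) * K ≤ j₂ * K := Nat.mul_le_mul_right _ (by omega)
      have hm2J : (j₂ + 1) * K ≤ J * K := Nat.mul_le_mul_right _ (by omega)
      have hes : e ≤ s := by omega
      have hsE' : A + (j₂ + 1) * K ≤ E := by omega
      have hsE : s ≤ E := by omega
      have heA : A < e := by omega
      -- band on `[e, E]`
      have hband' : ∀ t, e ≤ t → t ≤ E →
          L ≤ rO t - rC t + m ∧ rO t ≤ rC t + L + m ∧ rC t ≤ rO t :=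
        fun t h1 h2 => hband t (by omega) h2
      -- `σ (e - 1) = x`
      have hσe : σ (e - 1) = x := by
        rw [hxdef]
        exact hcolour j₁ hj₁ (e - 1) (by omega) (by omega)
      -- (D2) on block `j₁`: the queue at time `e` is all `x`
      have hD2₁ : ∀ k, rC e ≤ k → k < rO e → σ (o k) = x := by
        intro k hk1 hk2
        have hs₀ : A + j₁ * K + 2 * L + 4 * m + 2 ≤ e := by omega
        exact mono_queue_of_mono_interval hO0 hC0 hOs hCs ho hc hresp hs₀
          ((rankO_mono hOs (by omega : e ≤ E)).trans hn)
          (hband _ (by omega) (by omega)).2.1 (hband _ (by omega) (by omega)).2.1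
          (fun t h1 h2 => hcolour j₁ hj₁ t h1 (by omega)) (by omega) le_rfl hk1 hk2
      have hNe : ((range n').filter fun k => rC e ≤ k ∧ k < rO e ∧ σ (o k) ≠ x).card = 0 := by
        rw [card_eq_zero, filter_eq_empty_iff]
        intro k _ ⟨h1, h2, h3⟩
        exact h3 (hD2₁ k h1 h2)
      -- (D2) on block `j₂`: the queue at time `s` is all `σ (A + j₂ K) ≠ x`
      have hD2₂ : ∀ k, rC s ≤ k → k < rO s → σ (o k) ≠ x := by
        intro k hk1 hk2
        have hs₀ : A + j₂ * K + 2 * L + 4 * m + 2 ≤ A + (j₂ + 1) * K := by omega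
        have := mono_queue_of_mono_interval hO0 hC0 hOs hCs ho hc hresp hs₀
          ((rankO_mono hOs hsE').trans hn)
          (hband _ (by omega) (by omega)).2.1 (hband _ (by omega) hsE').2.1
          (fun t h1 h2 => hcolour j₂ hj₂ t h1 h2) (le_refl s) (by omega) hk1 hk2
        rw [this]; exact hneq
      have hmb := many_boundaries_of_two_colours hOs hCs ho hc hresp x hes hsE hn hband' hσe
        hNe hD2₂
      -- the counted boundaries lie in `Bd x`
      have hsubB : ((range s).filter fun u => e < u ∧ σ (u - 1) ≠ x ∧ σ u = x) ⊆ Bd x := by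
        intro u hu
        rw [mem_filter, mem_range] at hu
        simp only [hBd, mem_filter, mem_range]
        exact ⟨by omega, by omega, hu.2.2.1, hu.2.2.2⟩
      have hcard := card_le_card hsubB
      have hltx := hlt x
      have : 2 * m * (((range s).filter fun u => e < u ∧ σ (u - 1) ≠ x ∧ σ u = x).card + 1)
          ≤ 2 * m * r := Nat.mul_le_mul_left _ (by omega)
      omega
    rcases lt_or_gt_of_ne (show j₀ ≠ j₃ by rintro rfl; exact hne rfl) with h03 | h30
    · exact key j₀ hj₀ j₃ hj₃ h03 hne
    · exact key j₃ hj₃ j₀ hj₀ h30 (Ne.symm hne)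

end Blocks

end Summit.ValiantsHypothesis.ValiantsHypothesis.Theorems.FifoMatching.NNMonotoneHard
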